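import Literature.NumberTheory.Automorphic.HidaTowerLevelTransport
import Literature.NumberTheory.Automorphic.HidaTowerDegreeZeroOrdinary
import HarnessLib

/-!
# Lemma D: operators killing the ordinary `H¹, H²` at one deep level are small at a continuous point

Topic `NumberTheory/Automorphic`; namespace `Literature.NumberTheory.Automorphic.BigHeckeGLn.TameLevel`;
theorems only (no new definitions, no named fact, no `sorry`).

`GL₂` over a number field `K`, tame level `U` maximal above `p`, `x : 𝕋^{S,ord}(U) → A` a continuous
point with values in a normed division ring of characteristic zero, `x̃ = x ∘ heckePolyHom` on
`ℤ[T^abs]`.  **Lemma D** (`exists_level_forall_norm_lt_of_laKills`): for every `ε > 0` there is a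
level depth `c` such that every `z ∈ ℤ[T^abs]` killing the ordinary parts of `H¹(U(c,c), ℤ/p^c)` and
`H²(U(c,c), ℤ/p^c)` has `‖x̃(z)‖ < ε`, GIVEN the Borel–Serre finiteness `hX`, `cd ≤ 2` at neat levels
`hcd`, and a neatness threshold `hr₀` (`HidaLevelNeat`).

Proof: continuity of `x` gives a finite set `Σ` of factors `H^i(X_{U(r)}, ℤ/p^s)^{ord}` controlling
`‖x̃‖ < ε ‖M‖` (`exists_finset_forall_norm_apply_heckePolyHom_lt`); with `c` larger than all
`r, s` occurring in `Σ` and than the neat threshold, `M z` kills every factor in `Σ`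
(`M = (B₀²)!` the uniform constant of `HidaTowerLevelTransport`): degree `0` factors vanish
(`ordinaryPart_zero_eq_bot`), degrees `1, 2` by the transports `laKills_tower_one/two`, degrees
`≥ 3` are killed by an index `N₀ ∣ M` (`exists_nsmul_laCohomology_three_eq_zero`); finally
`x̃(M z) = M x̃(z)` and `M ≠ 0` in `A`.

[cite: Hida1994AIF, §3, Thm 3.2 and its proof] [cite: KhareThorne2017, §6.5, Lemma 6.17]

## References

* H. Hida, Ann. Inst. Fourier 44 (1994), §3. [Hida1994AIF]
* C. Khare, J. A. Thorne, Amer. J. Math. 139 (2017), §6.5. [KhareThorne2017]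
-/

noncomputable section

open CategoryTheory IsDedekindDomain
open scoped NumberField

namespace Literature.NumberTheory.Automorphic

namespace BigHeckeGLn

namespace TameLevel

open LevelAction

variable {K : Type} [Field K] [NumberField K] {p : ℕ} [Fact p.Prime] (𝒰 : TameLevel 2 K p)
  [Fact 𝒰.IsMaximalAbove]

omit [Fact 𝒰.IsMaximalAbove] in
/-- `N • H^i(U(r, max r 1), ℤ/p^s) = 0` transports to the tower factor `H^i(X_{U(r)}, ℤ/p^s)`
through `towerBridge`. [folklore] -/
theorem nsmul_hidaCohomology_eq_zero {N i r s : ℕ} (h : ∀ w : 𝒰.laCohomology ℤ r (max r 1) s i, N • w = 0)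
    (m : 𝒰.hidaCohomology ℤ (i, r, s)) : N • m = 0 := by
  have h1 : (𝒰.towerBridge ℤ r s i).hom.hom (N • m) = 0 := (map_nsmul _ N m).trans (h _)
  have h2 : (𝒰.towerBridge ℤ r s i).inv.hom ((𝒰.towerBridge ℤ r s i).hom.hom (N • m)) = N • m := by
    change ((𝒰.towerBridge ℤ r s i).hom ≫ (𝒰.towerBridge ℤ r s i).inv).hom (N • m) = N • m
    rw [Iso.hom_inv_id]
    rfl
  have h3 : (𝒰.towerBridge ℤ r s i).inv.hom 0 = 0 := map_zero _
  rw [h1] at h2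
  exact h2.symm.trans h3

/-- **Lemma D.**  For every `ε > 0` there is `c ≥ max r₀ 1` such that `‖x̃(z)‖ < ε` for every
`z ∈ ℤ[T^abs]` killing the ordinary parts of `H¹(U(c,c), ℤ/p^c)` and `H²(U(c,c), ℤ/p^c)`, GIVEN
`hX`, `hcd`, `hr₀`. [cite: Hida1994AIF, §3, proof of Thm 3.2] [cite: KhareThorne2017, §6.5, Lemma 6.17] -/
theorem exists_level_forall_norm_lt_of_laKills (hX : BorelSerre1973_finite_groupCohomology_congruenceSubgroup)
    (hcd : ∀ (W : Subgroup (FiniteAdelicGL 2 K)),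
      IsOpen (W : Set (FiniteAdelicGL 2 K)) → IsCompact (W : Set (FiniteAdelicGL 2 K)) →
      (∀ γ ∈ W.comap (globalEmbedding 2 K), IsOfFinOrder γ → γ = 1) →
      ∀ (A : Rep ℤ (W.comap (globalEmbedding 2 K))) (q : ℕ), 3 ≤ q → Subsingleton (groupCohomology A q))
    {r₀ : ℕ}
    (hr₀ : ∀ r : ℕ, r₀ ≤ r → ∀ (g : FiniteAdelicGL 2 K) (γ : GL (Fin 2) K), IsOfFinOrder γ →
      g⁻¹ * globalEmbedding 2 K γ * g ∈ 𝒰.hidaLevel r → γ = 1)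
    {A : Type*} [NormedDivisionRing A] [CharZero A]
    (x : OrdinaryHeckeAlgebraGLn 𝒰 →+* A) (hx : Continuous x) {ε : ℝ} (hε : 0 < ε) :
    ∃ c : ℕ, max r₀ 1 ≤ c ∧ ∀ z : MvPolynomial 𝒰.hidaElements ℤ,
      𝒰.LaKills c c c 1 z → 𝒰.LaKills c c c 2 z → ‖x (𝒰.heckePolyHom z)‖ < ε := by
  have h𝒰 : 𝒰.IsMaximalAbove := Fact.out
  set B₀ := (𝒰.level (max r₀ 1) (max r₀ 1)).relIndex (𝒰.level 0 1) with hB₀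
  set M : ℕ := (B₀ ^ 2).factorial with hMdef
  have hM : (M : A) ≠ 0 := Nat.cast_ne_zero.2 (Nat.factorial_ne_zero _)
  have hMpos : 0 < ‖(M : A)‖ := norm_pos_iff.2 hM
  obtain ⟨I, hI⟩ := 𝒰.exists_finset_forall_norm_apply_heckePolyHom_lt x hx (mul_pos hMpos hε)
  set c := max (max r₀ 1) (I.sup fun y => max y.2.1 y.2.2) with hc
  have hRc : max r₀ 1 ≤ c := le_max_left _ _
  have hc1 : 1 ≤ c := (le_max_right r₀ 1).trans hRc
  refine ⟨c, hRc, fun z hz1 hz2 => ?_⟩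
  -- `M z` kills every factor in `I`
  have hkill : ∀ y ∈ I, ∀ m : 𝒰.ordinaryPart ℤ y, (MvPolynomial.C (M : ℤ) * z) • m = 0 := by
    rintro ⟨i, r, s⟩ hy m
    have hrs : max r s ≤ c := (Finset.le_sup (f := fun y : TowerIndex => max y.2.1 y.2.2) hy).trans (le_max_right _ _)
    have hr : r ≤ c := (le_max_left r s).trans hrs
    have hs : s ≤ c := (le_max_right r s).trans hrs
    rcases i with _ | _ | _ | i
    · -- degree `0`: the factor vanishes
      have hm : (m : 𝒰.hidaCohomology ℤ (0, r, s)) ∈ (⊥ : Submodule ℤ _) := by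
        rw [← 𝒰.ordinaryPart_zero_eq_bot h𝒰 r s]; exact m.2
      rw [show m = 0 from Subtype.ext ((Submodule.mem_bot ℤ).1 hm), smul_zero]
    · -- degree `1`
      exact (𝒰.forall_smul_eq_zero_iff_laPolyHom r s 1 _).2
        (𝒰.laKills_mul_C M z (𝒰.laKills_tower_one hX hc1 hr hs z hz1)) m
    · -- degree `2`
      exact (𝒰.forall_smul_eq_zero_iff_laPolyHom r s 2 _).2 (𝒰.laKills_tower_two hX hcd hr₀ hRc hr hs z hz2) m
    · -- degrees `≥ 3`: killed by `N₀ ∣ M`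
      obtain ⟨N₀, hN₀, hN₀le, hN₀kill⟩ := 𝒰.exists_nsmul_laCohomology_three_eq_zero hcd hr₀ r
        (le_max_right r 1) s (by omega : 3 ≤ i + 3)
      obtain ⟨d, hd⟩ : N₀ ∣ M := Nat.dvd_factorial hN₀ (hN₀le.trans (Nat.le_self_pow two_ne_zero B₀))
      have hm0 : M • (m : 𝒰.hidaCohomology ℤ (i + 3, r, s)) = 0 := by
        rw [hd, mul_comm, mul_nsmul', 𝒰.nsmul_hidaCohomology_eq_zero hN₀kill, nsmul_zero]
      have hm : (M : MvPolynomial 𝒰.hidaElements ℤ) • m = 0 := by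
        rw [Nat.cast_smul_eq_nsmul]
        exact Subtype.ext (by rw [AddSubmonoidClass.coe_nsmul, hm0, ZeroMemClass.coe_zero])
      rw [mul_comm, mul_smul, MvPolynomial.C_eq_coe_nat, hm, smul_zero]
  have hlt := hI _ hkill
  rw [map_mul, MvPolynomial.C_eq_coe_nat, map_natCast, map_mul, map_natCast, norm_mul] at hlt
  exact lt_of_mul_lt_mul_left hlt (norm_nonneg _)

/-- **Lemma D, uniform in the level depth `c ≥ c₀` and the coefficient depth `c' ≥ c₀`.**
[cite: Hida1994AIF, §3, proof of Thm 3.2] [cite: KhareThorne2017, §6.5, Lemma 6.17] -/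
theorem exists_depth_forall_norm_lt_of_laKills (hX : BorelSerre1973_finite_groupCohomology_congruenceSubgroup)
    (hcd : ∀ (W : Subgroup (FiniteAdelicGL 2 K)),
      IsOpen (W : Set (FiniteAdelicGL 2 K)) → IsCompact (W : Set (FiniteAdelicGL 2 K)) →
      (∀ γ ∈ W.comap (globalEmbedding 2 K), IsOfFinOrder γ → γ = 1) →
      ∀ (A : Rep ℤ (W.comap (globalEmbedding 2 K))) (q : ℕ), 3 ≤ q → Subsingleton (groupCohomology A q))
    {r₀ : ℕ}
    (hr₀ : ∀ r : ℕ, r₀ ≤ r → ∀ (g : FiniteAdelicGL 2 K) (γ : GL (Fin 2) K), IsOfFinOrder γ →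
      g⁻¹ * globalEmbedding 2 K γ * g ∈ 𝒰.hidaLevel r → γ = 1)
    {A : Type*} [NormedDivisionRing A] [CharZero A]
    (x : OrdinaryHeckeAlgebraGLn 𝒰 →+* A) (hx : Continuous x) {ε : ℝ} (hε : 0 < ε) :
    ∃ c₀ : ℕ, max r₀ 1 ≤ c₀ ∧ ∀ c c' : ℕ, c₀ ≤ c → c₀ ≤ c' → ∀ z : MvPolynomial 𝒰.hidaElements ℤ,
      𝒰.LaKills c c c' 1 z → 𝒰.LaKills c c c' 2 z → ‖x (𝒰.heckePolyHom z)‖ < ε := by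
  have h𝒰 : 𝒰.IsMaximalAbove := Fact.out
  set B₀ := (𝒰.level (max r₀ 1) (max r₀ 1)).relIndex (𝒰.level 0 1) with hB₀
  set M : ℕ := (B₀ ^ 2).factorial with hMdef
  have hM : (M : A) ≠ 0 := Nat.cast_ne_zero.2 (Nat.factorial_ne_zero _)
  have hMpos : 0 < ‖(M : A)‖ := norm_pos_iff.2 hM
  obtain ⟨I, hI⟩ := 𝒰.exists_finset_forall_norm_apply_heckePolyHom_lt x hx (mul_pos hMpos hε)
  set c₀ := max (max r₀ 1) (I.sup fun y => max y.2.1 y.2.2) with hc₀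
  refine ⟨c₀, le_max_left _ _, fun c c' hc₀c hc₀c' z hz1 hz2 => ?_⟩
  have hRc : max r₀ 1 ≤ c := (le_max_left _ _).trans hc₀c
  have hc1 : 1 ≤ c := (le_max_right r₀ 1).trans hRc
  -- `M z` kills every factor in `I`
  have hkill : ∀ y ∈ I, ∀ m : 𝒰.ordinaryPart ℤ y, (MvPolynomial.C (M : ℤ) * z) • m = 0 := by
    rintro ⟨i, r, s⟩ hy m
    have hrs : max r s ≤ c₀ := (Finset.le_sup (f := fun y : TowerIndex => max y.2.1 y.2.2) hy).trans (le_max_right _ _)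
    have hr : r ≤ c := ((le_max_left r s).trans hrs).trans hc₀c
    have hs : s ≤ c' := ((le_max_right r s).trans hrs).trans hc₀c'
    rcases i with _ | _ | _ | i
    · -- degree `0`: the factor vanishes
      have hm : (m : 𝒰.hidaCohomology ℤ (0, r, s)) ∈ (⊥ : Submodule ℤ _) := by
        rw [← 𝒰.ordinaryPart_zero_eq_bot h𝒰 r s]; exact m.2
      rw [show m = 0 from Subtype.ext ((Submodule.mem_bot ℤ).1 hm), smul_zero]
    · -- degree `1`
      exact (𝒰.forall_smul_eq_zero_iff_laPolyHom r s 1 _).2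
        (𝒰.laKills_mul_C M z (𝒰.laKills_tower_one' hX hc1 hr hs z hz1)) m
    · -- degree `2`
      exact (𝒰.forall_smul_eq_zero_iff_laPolyHom r s 2 _).2 (𝒰.laKills_tower_two' hX hcd hr₀ hRc hr hs z hz2) m
    · -- degrees `≥ 3`: killed by `N₀ ∣ M`
      obtain ⟨N₀, hN₀, hN₀le, hN₀kill⟩ := 𝒰.exists_nsmul_laCohomology_three_eq_zero hcd hr₀ r
        (le_max_right r 1) s (by omega : 3 ≤ i + 3)
      obtain ⟨d, hd⟩ : N₀ ∣ M := Nat.dvd_factorial hN₀ (hN₀le.trans (Nat.le_self_pow two_ne_zero B₀))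
      have hm0 : M • (m : 𝒰.hidaCohomology ℤ (i + 3, r, s)) = 0 := by
        rw [hd, mul_comm, mul_nsmul', 𝒰.nsmul_hidaCohomology_eq_zero hN₀kill, nsmul_zero]
      have hm : (M : MvPolynomial 𝒰.hidaElements ℤ) • m = 0 := by
        rw [Nat.cast_smul_eq_nsmul]
        exact Subtype.ext (by rw [AddSubmonoidClass.coe_nsmul, hm0, ZeroMemClass.coe_zero])
      rw [mul_comm, mul_smul, MvPolynomial.C_eq_coe_nat, hm, smul_zero]
  have hlt := hI _ hkill
  rw [map_mul, MvPolynomial.C_eq_coe_nat, map_natCast, map_mul, map_natCast, norm_mul] at hlt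
  exact lt_of_mul_lt_mul_left hlt (norm_nonneg _)

end TameLevel

end BigHeckeGLn

end Literature.NumberTheory.Automorphic
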